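import Summits.PneNP.PneNP.Theorems.OneSliceConstantBandDefs
import Summits.PneNP.PneNP.Theorems.OneSliceConstantBandTransferStepAux
import Summits.PneNP.PneNP.Theorems.OneSliceSliceACZeroDefs

/-!
# Route OneSlice, crux `ConstantBand` (stmt-PneNP-2834): low-exponent rungs — counting helpers

Helper file (lead seat c7, 2026-08-17) for `Theorems/OneSliceConstantBandExponentOne.lean` (the unconditional rungs `c ≤ 1` of the
crux schedule), def-free:

* `filter_slice_eq_filter_wt`, `card_slice_eq_card_filter_wt`, `errSet_eq_filter_slice` — the slice / error set of
  `LoadBearing.lean` in the general cube vocabulary (`edgeCount = wt` definitionally);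
* `err_arith` — the real arithmetic of the two cases of `fprm_sliceErr_ge_of_junta`;
* `fprm_card_slice_cliqueTouch_le` (registered form `fprm_cliqueTouch`) — union bound: the graphs of slice `j` with a `k`-clique
  touching a set `V` of edges number at most `#V · C(n-2,k-2) · (j/C(n,2))^{C(k,2)} · #slice_j`;
* `choose_mul_eq_mul_choose_sub_two` — `C(n,k)·k(k-1) = n(n-1)·C(n-2,k-2)`.

[folklore]
-/

set_option linter.dupNamespace false

noncomputable section

namespace Summit.PneNP.PneNP.Cruxes.ConstantBand.FlatPriorRelativeMinterms

open Literature.Computability.Complexity Finset Filter Classical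
open Summit.PneNP.PneNP.Cruxes.SliceACZero.RussoWindowLadder (wt)

variable {n : ℕ}

/-! ## Slices in the cube vocabulary -/

/-- The slice of `LoadBearing.lean` filtered by `P` is a weight-slice filter of the general cube vocabulary
(`edgeCount = wt` definitionally). [folklore] -/
theorem filter_slice_eq_filter_wt (j : ℕ) (P : (Edge n → Bool) → Prop) [DecidablePred P] :
    (slice n j).filter P = univ.filter fun x : Edge n → Bool => wt x = j ∧ P x := by
  rw [slice, filter_filter]
  rfl

/-- `#slice_j` in the cube vocabulary. [folklore] -/
theorem card_slice_eq_card_filter_wt (n j : ℕ) :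
    #(slice n j) = #(univ.filter fun x : Edge n → Bool => wt x = j) := rfl

/-! ## The arithmetic of the two cases -/

/-- The real arithmetic behind `fprm_sliceErr_ge_of_junta`: with `s = #slice`, `a = #{f}`, `c₀ = #{CL₀}`,
`fc₀ = #{f ∧ CL₀}`, `c₁ = #{CL₁}`, `cl = #{CLIQUE}`, `E = #err`, `t = s/k!`. [folklore] -/
theorem err_arith {s a c0 fc0 c1 cl E t : ℝ} (hs : 0 < s) (ha0 : 0 ≤ a) (hc0 : 0 ≤ c0) (hts : t ≤ s / 6)
    (h1 : fc0 * s ≤ a * c0) (h2 : c0 ≤ fc0 + E) (h3 : a ≤ E + fc0 + c1) (h4 : c0 ≤ cl) (hup : cl ≤ s / 3)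
    (h5 : cl ≤ c0 + c1) (hlow : 5 / 6 * t ≤ cl) (h6 : c1 ≤ t / 12) : 3 / 8 * t ≤ E := by
  rcases le_total (2 * a) s with h | h
  · -- `f` accepts at most half of the slice: it rejects half of `CL₀`
    have e1 : 2 * fc0 * s ≤ c0 * s := by nlinarith [mul_le_mul_of_nonneg_right h hc0]
    have e2 : 2 * fc0 ≤ c0 := le_of_mul_le_mul_right e1 hs
    linarith
  · -- `f` accepts at least half of the slice: it accepts a third of the non-clique graphs
    have hc0s : c0 ≤ s / 3 := h4.trans hup
    have e1 : 3 * fc0 * s ≤ a * s := by nlinarith [mul_le_mul_of_nonneg_left hc0s ha0]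
    have e2 : 3 * fc0 ≤ a := le_of_mul_le_mul_right e1 hs
    linarith

/-! ## Cliques touching a set of edges are rare -/

/-- **Union bound for the cliques touching `V`.** The graphs of slice `j` containing a `k`-clique one of whose edges lies
in `V` number at most `#V · C(n-2, k-2) · (j / C(n,2))^{C(k,2)} · #slice_j`. [folklore] -/
theorem fprm_card_slice_cliqueTouch_le (V : Finset (Edge n)) {k j : ℕ} (hk : 2 ≤ k) (hj : j ≤ n.choose 2)
    (hN : 0 < n.choose 2) :
    (#((slice n j).filter fun x => ∃ A ∈ powersetCard k (univ : Finset (Fin n)),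
        (∃ e ∈ V, cliqueVec A e = true) ∧ ∀ e, cliqueVec A e = true → x e = true) : ℝ) ≤
      #V * ((n - 2).choose (k - 2) : ℝ) * (((j : ℝ) / n.choose 2) ^ k.choose 2 * #(slice n j)) := by
  set T : Finset (Finset (Fin n)) := (powersetCard k univ).filter fun A => ∃ e ∈ V, cliqueVec A e = true with hT
  set S : Finset (Fin n) → Finset (Edge n → Bool) := fun A =>
    (slice n j).filter fun x => ∀ e ∈ univ.filter (fun e => cliqueVec A e = true), x e = true with hS
  have hs : 0 < (#(slice n j) : ℝ) := by exact_mod_cast ts_card_slice_pos hj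
  -- the union bound over the touching sets
  have hsub : ((slice n j).filter fun x => ∃ A ∈ powersetCard k (univ : Finset (Fin n)),
      (∃ e ∈ V, cliqueVec A e = true) ∧ ∀ e, cliqueVec A e = true → x e = true) ⊆ T.biUnion S := by
    intro x hx
    rw [mem_filter] at hx
    obtain ⟨hxs, A, hA, htouch, hsup⟩ := hx
    refine mem_biUnion.2 ⟨A, mem_filter.2 ⟨hA, htouch⟩, mem_filter.2 ⟨hxs, fun e he => hsup e (mem_filter.1 he).2⟩⟩
  have hterm : ∀ A ∈ T, (#(S A) : ℝ) ≤ ((j : ℝ) / n.choose 2) ^ k.choose 2 * #(slice n j) := by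
    intro A hA
    have hAk : #A = k := (mem_powersetCard.1 (mem_filter.1 hA).1).2
    have h := ts_frac_slice_filter_supset_le (univ.filter fun e => cliqueVec A e = true) hj hN
    rw [card_filter_cliqueVec, hAk, div_le_iff₀ hs] at h
    exact h
  have hTcard : #T ≤ #V * (n - 2).choose (k - 2) := by
    have hTsub : T ⊆ V.biUnion fun e => (powersetCard k univ).filter fun A => cliqueVec A e = true := by
      intro A hA
      rw [mem_filter] at hA
      obtain ⟨hAk, e, heV, he⟩ := hA
      exact mem_biUnion.2 ⟨e, heV, mem_filter.2 ⟨hAk, he⟩⟩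
    refine (card_le_card hTsub).trans (card_biUnion_le.trans ?_)
    have heach : ∀ e ∈ V, #((powersetCard k univ).filter fun A : Finset (Fin n) => cliqueVec A e = true) =
        (n - 2).choose (k - 2) := by
      intro e _
      have h := card_filter_powersetCard_subset (endpts e) (univ : Finset (Fin n)) k (subset_univ _)
        (by rw [card_endpts]; exact hk)
      rw [card_univ, Fintype.card_fin, card_endpts] at h
      rw [← h]
      congr 1
      exact filter_congr fun A _ => cliqueVec_eq_true_iff_endpts A e
    rw [sum_congr rfl heach, sum_const, smul_eq_mul]
  calc (#((slice n j).filter fun x => ∃ A ∈ powersetCard k (univ : Finset (Fin n)),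
          (∃ e ∈ V, cliqueVec A e = true) ∧ ∀ e, cliqueVec A e = true → x e = true) : ℝ)
      ≤ #(T.biUnion S) := by exact_mod_cast card_le_card hsub
    _ ≤ ∑ A ∈ T, (#(S A) : ℝ) := by exact_mod_cast card_biUnion_le
    _ ≤ ∑ _A ∈ T, ((j : ℝ) / n.choose 2) ^ k.choose 2 * #(slice n j) := sum_le_sum hterm
    _ = #T * (((j : ℝ) / n.choose 2) ^ k.choose 2 * #(slice n j)) := by rw [sum_const, nsmul_eq_mul]
    _ ≤ #V * ((n - 2).choose (k - 2) : ℝ) * (((j : ℝ) / n.choose 2) ^ k.choose 2 * #(slice n j)) := by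
        apply mul_le_mul_of_nonneg_right _ (by positivity)
        exact_mod_cast hTcard

/-- **Registered form** (sub-goal `fprm_cliqueTouch` of stmt-PneNP-2834): the union bound for cliques touching a set of edges,
all binders explicit. [folklore] -/
theorem fprm_cliqueTouch :
    ∀ (n : ℕ) (V : Finset (Edge n)) (k j : ℕ), 2 ≤ k → j ≤ n.choose 2 → 0 < n.choose 2 →
      (#((slice n j).filter fun x => ∃ A ∈ powersetCard k (univ : Finset (Fin n)),
          (∃ e ∈ V, cliqueVec A e = true) ∧ ∀ e, cliqueVec A e = true → x e = true) : ℝ) ≤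
        #V * ((n - 2).choose (k - 2) : ℝ) * (((j : ℝ) / n.choose 2) ^ k.choose 2 * #(slice n j)) :=
  fun _ V _ _ hk hj hN => fprm_card_slice_cliqueTouch_le V hk hj hN

/-! ## The error set and a binomial identity -/

/-- `errSet` of `LoadBearing.lean` is the disagreement filter of the slice. [folklore] -/
theorem errSet_eq_filter_slice (n k j : ℕ) (C : Circuit (Edge n)) :
    errSet n k j C = (slice n j).filter fun x => C.eval x ≠ cliqueFn n k x := by
  rw [errSet, slice, filter_filter]

/-- `C(n,k) · k(k-1) = n(n-1) · C(n-2,k-2)` for `n, k ≥ 2` (absorption, twice). [folklore] -/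
theorem choose_mul_eq_mul_choose_sub_two {n k : ℕ} (hn : 2 ≤ n) (hk : 2 ≤ k) :
    n.choose k * (k * (k - 1)) = n * (n - 1) * (n - 2).choose (k - 2) := by
  obtain ⟨m, rfl⟩ : ∃ m, n = m + 2 := ⟨n - 2, by omega⟩
  obtain ⟨l, rfl⟩ : ∃ l, k = l + 2 := ⟨k - 2, by omega⟩
  simp only [Nat.add_sub_cancel]
  have h1 := Nat.add_one_mul_choose_eq (m + 1) (l + 1)
  have h2 := Nat.add_one_mul_choose_eq m l
  -- `(m+2)·C(m+1,l+1) = C(m+2,l+2)·(l+2)` and `(m+1)·C(m,l) = C(m+1,l+1)·(l+1)`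
  have : (m + 2) * (m + 1) * m.choose l = (m + 2).choose (l + 2) * ((l + 2) * (l + 1)) := by
    calc (m + 2) * (m + 1) * m.choose l = (m + 2) * ((m + 1) * m.choose l) := by ring
      _ = (m + 2) * ((m + 1).choose (l + 1) * (l + 1)) := by rw [h2]
      _ = ((m + 1 + 1) * (m + 1).choose (l + 1)) * (l + 1) := by ring
      _ = ((m + 1 + 1).choose (l + 1 + 1) * (l + 1 + 1)) * (l + 1) := by rw [h1]
      _ = (m + 2).choose (l + 2) * ((l + 2) * (l + 1)) := by ring
  rw [show m + 2 - 1 = m + 1 by omega, show l + 2 - 1 = l + 1 by omega]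
  linarith

end Summit.PneNP.PneNP.Cruxes.ConstantBand.FlatPriorRelativeMinterms

end
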